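import Mathlib.MeasureTheory.Measure.Lebesgue.EqHaar
import Mathlib.MeasureTheory.Measure.Haar.Unique
import Mathlib.Analysis.Normed.Ring.Units
import Mathlib.Analysis.Normed.Module.FiniteDimension
import Mathlib.RingTheory.Norm.Defs
import Mathlib.MeasureTheory.Group.Arithmetic
import HarnessLib

/-!
# Haar measure on the unit group of a finite-dimensional real algebra: the density `|N(x)|⁻¹ dx`

`Literature/MeasureTheory/Group` support file (everything proved; one definition). Let `A` be a
finite-dimensional real normed algebra (e.g. `M_n(ℝ)`, `M_n(ℂ)`, `M_n(K ⊗_ℚ ℝ)`), `dx` an additive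
Haar (= Lebesgue) measure on `A`, and `N = N_{A/ℝ} : A → ℝ` the algebra norm, `N(x) = det(y ↦ x y)`
(Mathlib `Algebra.norm ℝ`). The unit group `Aˣ` is open in `A` (Mathlib `Units.isOpenEmbedding_val`)
and the classical formula for its Haar measure is

  `d^×x = |N(x)|⁻¹ dx`   (for `A = M_n(ℝ)`: `d^×x = |det x|^{-n} ∏ dx_{ij}`),

a classical consequence of the Jacobian formula for linear maps (Bourbaki, *Intégration*, Ch. VII,
§1 (module of an automorphism) with Ch. VIII (Haar measure of the multiplicative group of a
finite-dimensional algebra); Godement–Jacquet, LNM 260, §8, take the archimedean local zeta integrals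
against this `d^×x`). We prove it in the following form:

* `unitsHaarOfAddHaar dx` — the measure `|N(x)|⁻¹ dx` transported to `Aˣ` (Mathlib `Measure.comap`
  of `dx.withDensity` along `Units.val`), and `isHaarMeasure_unitsHaarOfAddHaar`: **it is a Haar
  measure on `Aˣ`** (left invariance: `y ↦ x y` scales `dx` by `|N(x)|`, Mathlib
  `map_linearMap_addHaar_eq_smul_addHaar`, and `N` is multiplicative; finite on compacts and
  positive on opens because `|N|⁻¹` is continuous and positive on `Aˣ`).
* `lintegral_unitsHaarOfAddHaar` — `∫_{Aˣ} g(x) d(unitsHaarOfAddHaar dx) = ∫_{x ∈ A, x unit} g(x) |N(x)|⁻¹ dx`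
  for measurable `g ≥ 0` on `A`.
* `exists_lintegral_units_eq_mul_lintegral` — **for every Haar measure `ρ` on `Aˣ` there is
  `c ∈ (0, ∞)` with `∫_{Aˣ} g(x) dρ = c ∫_{x unit} g(x) |N(x)|⁻¹ dx`** (uniqueness of Haar measure,
  Mathlib `isMulLeftInvariant_eq_smul`), and the integrability criterion
  `integrable_comp_val_of_integrable` (`g ∘ val ∈ L¹(ρ)` as soon as `|N|⁻¹ g ∈ L¹(dx|_{units})`).
* On the way: `Units.borelSpace_of_isOpenEmbedding` (Mathlib's `MeasurableSpace Aˣ`, the comap of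
  the Borel σ-algebra along `val`, is the Borel σ-algebra of `Aˣ`), `measurableEmbedding_unitsVal`,
  `continuous_algebraNorm` (`N` is continuous in finite dimension).

Consumer: the convergence of the global Godement–Jacquet zeta integral at the archimedean places
(`∫_{GL_n(K_∞)} |Φ_∞(x)| |det x|^σ d^×x = c ∫_{M_n(K_∞)} |Φ_∞(x)| |det x|_∞^{σ-n} dx < ∞` for
Schwartz `Φ_∞` and `σ ≥ n`), discharge of `GodementJacquet1972_gjZeta_meromorphic`.

Mathlib has the Jacobian of linear maps for additive Haar measure (`addHaar_preimage_linearMap`,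
`map_linearMap_addHaar_eq_smul_addHaar`), Haar uniqueness, and `MeasurableSpace Mˣ`
(`Units.instMeasurableSpace`), but no statement relating multiplicative and additive Haar measures
of a ring beyond `ℝ` (`Real.volume` on `ℝˣ`‐type results are absent too); `lean search
'unitsHaar|Units.*IsHaarMeasure.*withDensity'` finds nothing in Mathlib or Literature.

## References

* N. Bourbaki, *Intégration*, Ch. VII §1, Ch. VIII (Haar measure of the multiplicative group of a
  finite-dimensional algebra: `|N_{A/ℝ}(x)|⁻¹ dx`) [folklore; not held, cited from memory for
  orientation only — every declaration below is tagged folklore and fully proved].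
* R. Godement, H. Jacquet, *Zeta functions of simple algebras*, LNM 260 (1972), §8
  [GodementJacquet1972].
-/

noncomputable section

open MeasureTheory MeasureTheory.Measure Set Filter Topology
open scoped ENNReal NNReal

namespace Literature.MeasureTheory.Group

/-! ### Topology and measurability of the unit group -/

section UnitsTopology

variable {A : Type*} [NormedRing A]

/-- The range of `val : Aˣ → A` is the set of units. [folklore] -/
theorem range_unitsVal_eq : range (Units.val : Aˣ → A) = {x | IsUnit x} :=
  Set.ext fun _ => ⟨fun ⟨u, hu⟩ => hu ▸ u.isUnit, fun h => ⟨h.unit, h.unit_spec⟩⟩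

variable [HasSummableGeomSeries A]

/-- The unit group of a normed ring with summable geometric series is locally compact when the ring
is (open subspace, Mathlib `Units.isOpenEmbedding_val`). [folklore] -/
theorem Units.locallyCompactSpace [LocallyCompactSpace A] : LocallyCompactSpace Aˣ :=
  (Units.isOpenEmbedding_val (R := A)).locallyCompactSpace

/-- The unit group is second countable when the ring is. [folklore] -/
theorem Units.secondCountableTopology [SecondCountableTopology A] : SecondCountableTopology Aˣ :=
  (Units.isOpenEmbedding_val (R := A)).isEmbedding.secondCountableTopology

variable [MeasurableSpace A] [BorelSpace A]

/-- `val : Aˣ → A` is a measurable embedding for Mathlib's σ-algebra `comap val` on `Aˣ` (its range,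
the set of units, is open). [folklore] -/
theorem measurableEmbedding_unitsVal : MeasurableEmbedding (Units.val : Aˣ → A) where
  injective := Units.val_injective
  measurable := fun s hs => ⟨s, hs, rfl⟩
  measurableSet_image' := by
    rintro _ ⟨t, ht, rfl⟩
    rw [image_preimage_eq_inter_range, range_unitsVal_eq]
    exact ht.inter Units.isOpen.measurableSet

/-- Mathlib's σ-algebra on `Aˣ` (the comap of the Borel σ-algebra of `A` along `val`) is the Borel
σ-algebra of `Aˣ`, because `val` is a topological embedding (`Units.isOpenEmbedding_val`) and
`borel (induced) = comap borel`. A local instance for this file's consumers; Mathlib has no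
`BorelSpace` instance on unit groups. [folklore] -/
theorem Units.borelSpace_of_isOpenEmbedding : BorelSpace Aˣ := by
  constructor
  have hind : (inferInstance : TopologicalSpace Aˣ) =
      TopologicalSpace.induced (Units.val : Aˣ → A) inferInstance :=
    (Units.isOpenEmbedding_val (R := A)).toIsInducing.eq_induced
  change MeasurableSpace.comap Units.val (inferInstance : MeasurableSpace A) = @borel Aˣ inferInstance
  rw [BorelSpace.measurable_eq (α := A), ← borel_comap]
  exact congrArg (@borel Aˣ) hind.symm

end UnitsTopology

/-! ### The algebra norm: non-vanishing on units, continuity -/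

section Norm

variable {A : Type*} [NormedRing A] [NormedAlgebra ℝ A]

/-- The algebra norm of a unit is non-zero. [folklore] -/
theorem algebraNorm_ne_zero_of_isUnit {x : A} (hx : IsUnit x) : Algebra.norm ℝ x ≠ 0 :=
  (hx.map (Algebra.norm ℝ)).ne_zero

/-- Multiplicativity in the form used below: `|N(x y)|⁻¹ = |N(x)|⁻¹ |N(y)|⁻¹`. [folklore] -/
theorem abs_inv_algebraNorm_mul (x y : A) :
    |(Algebra.norm ℝ (x * y))⁻¹| = |(Algebra.norm ℝ x)⁻¹| * |(Algebra.norm ℝ y)⁻¹| := by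
  rw [map_mul, mul_inv, abs_mul]

variable [FiniteDimensional ℝ A]

/-- In a finite-dimensional real normed algebra the algebra norm `N(x) = det(y ↦ x y)` is continuous
(`x ↦ (y ↦ x y)` is linear into the continuous endomorphisms, on which `det` is continuous,
Mathlib `ContinuousLinearMap.continuous_det`). [folklore] -/
theorem continuous_algebraNorm : Continuous (Algebra.norm ℝ : A → ℝ) := by
  let L : A →ₗ[ℝ] (A →L[ℝ] A) :=
    (LinearMap.toContinuousLinearMap : (A →ₗ[ℝ] A) ≃ₗ[ℝ] (A →L[ℝ] A)).toLinearMap ∘ₗ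
      (Algebra.lmul ℝ A).toLinearMap
  have hL : Continuous L := L.continuous_of_finiteDimensional
  have heq : (Algebra.norm ℝ : A → ℝ) = (fun f : A →L[ℝ] A => f.det) ∘ L := by
    funext x
    simp only [Function.comp_apply, Algebra.norm_apply]
    exact (LinearMap.det_toContinuousLinearMap _).symm
  rw [heq]
  exact ContinuousLinearMap.continuous_det.comp hL

end Norm

/-! ### The density `|N(x)|⁻¹` -/

section DensityDef

variable {A : Type*} [NormedRing A] [NormedAlgebra ℝ A]

/-- The density `x ↦ |N_{A/ℝ}(x)|⁻¹` (as an extended non-negative real). [folklore] -/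
def unitsDensity (x : A) : ℝ≥0∞ :=
  ENNReal.ofReal |(Algebra.norm ℝ x)⁻¹|

/-- Unfolding `unitsDensity`. [folklore] -/
theorem unitsDensity_apply (x : A) : unitsDensity x = ENNReal.ofReal |(Algebra.norm ℝ x)⁻¹| := rfl

/-- The density at `1` is `1`. [folklore] -/
@[simp]
theorem unitsDensity_one : unitsDensity (1 : A) = 1 := by
  simp [unitsDensity_apply]

/-- The density does not vanish at units. [folklore] -/
theorem unitsDensity_ne_zero_of_isUnit {x : A} (hx : IsUnit x) : unitsDensity x ≠ 0 := by
  rw [unitsDensity_apply, Ne, ENNReal.ofReal_eq_zero, not_le, abs_pos]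
  exact inv_ne_zero (algebraNorm_ne_zero_of_isUnit hx)

/-- Multiplicativity of the density: `|N(x y)|⁻¹ = |N(x)|⁻¹ |N(y)|⁻¹`. [folklore] -/
theorem unitsDensity_mul (x y : A) : unitsDensity (x * y) = unitsDensity x * unitsDensity y := by
  rw [unitsDensity_apply, unitsDensity_apply, unitsDensity_apply, abs_inv_algebraNorm_mul,
    ENNReal.ofReal_mul (abs_nonneg _)]

variable [FiniteDimensional ℝ A] [MeasurableSpace A] [BorelSpace A]

/-- The density is Borel measurable (indeed continuous on units). [folklore] -/
theorem measurable_unitsDensity : Measurable (unitsDensity : A → ℝ≥0∞) :=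
  ENNReal.measurable_ofReal.comp (continuous_abs.measurable.comp
    (continuous_algebraNorm.measurable.inv))

end DensityDef

/-! ### The measure `|N(x)|⁻¹ dx` on `Aˣ` -/

section Density

variable {A : Type*} [NormedRing A] [NormedAlgebra ℝ A] [FiniteDimensional ℝ A]
  [MeasurableSpace A] [BorelSpace A]

variable (dx : Measure A)

/-- **The measure `|N(x)|⁻¹ dx` on the unit group `Aˣ`** of a finite-dimensional real normed
algebra: the additive Haar measure `dx` with density `|N_{A/ℝ}(x)|⁻¹`, pulled back along the open
embedding `val : Aˣ → A` (classically the Haar measure of `Aˣ`; for `A = M_n(ℝ)` it is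
`|det x|^{-n} dx`). [folklore] -/
def unitsHaarOfAddHaar : Measure Aˣ :=
  Measure.comap Units.val (dx.withDensity unitsDensity)

variable [HasSummableGeomSeries A]

attribute [local instance] Units.borelSpace_of_isOpenEmbedding

omit [FiniteDimensional ℝ A] in
/-- The value of `|N|⁻¹ dx` on a measurable subset of `Aˣ` is the weighted additive measure of its
image in `A`. [folklore] -/
theorem unitsHaarOfAddHaar_apply {s : Set Aˣ} (hs : MeasurableSet s) :
    unitsHaarOfAddHaar dx s = ∫⁻ x in Units.val '' s, unitsDensity x ∂dx := by
  rw [unitsHaarOfAddHaar, measurableEmbedding_unitsVal.comap_apply,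
    withDensity_apply _ (measurableEmbedding_unitsVal.measurableSet_image.2 hs)]

/-- **`∫_{Aˣ} g(x) |N(x)|⁻¹ dx` computed on `A`**: for measurable `g ≥ 0` on `A`,
`∫ g(↑u) d(unitsHaarOfAddHaar dx)(u) = ∫_{x unit} g(x) |N(x)|⁻¹ dx`. [folklore] -/
theorem lintegral_unitsHaarOfAddHaar {g : A → ℝ≥0∞} (hg : Measurable g) :
    ∫⁻ u, g (u : A) ∂unitsHaarOfAddHaar dx = ∫⁻ x in {x : A | IsUnit x}, g x * unitsDensity x ∂dx := by
  rw [← measurableEmbedding_unitsVal.lintegral_map g, unitsHaarOfAddHaar,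
    measurableEmbedding_unitsVal.map_comap, range_unitsVal_eq,
    restrict_withDensity Units.isOpen.measurableSet,
    lintegral_withDensity_eq_lintegral_mul _ measurable_unitsDensity hg]
  refine lintegral_congr fun x => ?_
  simp only [Pi.mul_apply, mul_comm]

omit [NormedAlgebra ℝ A] [FiniteDimensional ℝ A] [MeasurableSpace A] [BorelSpace A]
  [HasSummableGeomSeries A] in
/-- The image under `val` of a left translate: `val '' ((u * ·)⁻¹' s) = (↑u * ·)⁻¹' (val '' s)`.
[folklore] -/
theorem image_val_preimage_mul_left (u : Aˣ) (s : Set Aˣ) :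
    Units.val '' ((fun v : Aˣ => u * v) ⁻¹' s) = (fun x : A => (u : A) * x) ⁻¹' (Units.val '' s) := by
  ext x
  constructor
  · rintro ⟨v, hv, rfl⟩
    exact ⟨u * v, hv, by rw [Units.val_mul]⟩
  · rintro ⟨w, hw, hwx⟩
    refine ⟨u⁻¹ * w, ?_, ?_⟩
    · show u * (u⁻¹ * w) ∈ s
      rwa [mul_inv_cancel_left]
    · show ((u⁻¹ * w : Aˣ) : A) = x
      rw [Units.val_mul, hwx, ← mul_assoc, Units.inv_mul, one_mul]

variable [dx.IsAddHaarMeasure]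

/-- **Left invariance of `|N(x)|⁻¹ dx`.** For a unit `u`, the linear map `y ↦ u y` of `A` pushes `dx`
to `|N(u)|⁻¹ dx` (Mathlib `map_linearMap_addHaar_eq_smul_addHaar`, `N(u) = det(y ↦ u y)`), which is
exactly compensated by `|N(x)|⁻¹ = |N(u⁻¹)|⁻¹ |N(u x)|⁻¹`. [folklore] -/
theorem isMulLeftInvariant_unitsHaarOfAddHaar : (unitsHaarOfAddHaar dx).IsMulLeftInvariant := by
  refine ⟨fun u => Measure.ext fun s hs => ?_⟩
  rw [map_apply (measurable_const_mul u) hs, unitsHaarOfAddHaar_apply dx (measurable_const_mul u hs),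
    unitsHaarOfAddHaar_apply dx hs, image_val_preimage_mul_left]
  set T : Set A := Units.val '' s with hT
  have hTm : MeasurableSet T := measurableEmbedding_unitsVal.measurableSet_image.2 hs
  -- the linear map `y ↦ u y` and its determinant
  set f : A →ₗ[ℝ] A := Algebra.lmul ℝ A (u : A) with hf
  have hfapply : ∀ y : A, f y = (u : A) * y := fun y => rfl
  have hdet : LinearMap.det f = Algebra.norm ℝ (u : A) := rfl
  have hdet0 : LinearMap.det f ≠ 0 := by rw [hdet]; exact algebraNorm_ne_zero_of_isUnit u.isUnit
  have hmap : Measure.map f dx = ENNReal.ofReal |(LinearMap.det f)⁻¹| • dx :=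
    map_linearMap_addHaar_eq_smul_addHaar dx hdet0
  have hdens : ENNReal.ofReal |(LinearMap.det f)⁻¹| = unitsDensity (u : A) := by rw [hdet]; rfl
  have hfm : Measurable f := f.continuous_of_finiteDimensional.measurable
  have hpre : (fun x : A => (u : A) * x) ⁻¹' T = f ⁻¹' T := rfl
  set G : A → ℝ≥0∞ := fun y => unitsDensity ((u⁻¹ : Aˣ) : A) * unitsDensity y with hG
  have hGm : Measurable G := measurable_unitsDensity.const_mul _
  calc ∫⁻ x in (fun x : A => (u : A) * x) ⁻¹' T, unitsDensity x ∂dx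
      = ∫⁻ x, (f ⁻¹' T).indicator unitsDensity x ∂dx := by
        rw [hpre, lintegral_indicator (hfm hTm)]
    _ = ∫⁻ x, (T.indicator G) (f x) ∂dx := by
        refine lintegral_congr fun x => ?_
        rw [← Set.indicator_comp_right]
        by_cases hx : x ∈ f ⁻¹' T
        · rw [indicator_of_mem hx, indicator_of_mem hx, Function.comp_apply, hG, hfapply]
          show unitsDensity x = unitsDensity ((u⁻¹ : Aˣ) : A) * unitsDensity ((u : A) * x)
          rw [← unitsDensity_mul, ← mul_assoc, Units.inv_mul, one_mul]
        · rw [indicator_of_notMem hx, indicator_of_notMem hx]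
    _ = ∫⁻ y, T.indicator G y ∂(Measure.map f dx) := by
        rw [lintegral_map (hGm.indicator hTm) hfm]
    _ = ENNReal.ofReal |(LinearMap.det f)⁻¹| * ∫⁻ y, T.indicator G y ∂dx := by
        rw [hmap, lintegral_smul_measure]; rfl
    _ = unitsDensity (u : A) * (unitsDensity ((u⁻¹ : Aˣ) : A) * ∫⁻ y in T, unitsDensity y ∂dx) := by
        rw [hdens, lintegral_indicator hTm, hG, lintegral_const_mul _ measurable_unitsDensity]
    _ = ∫⁻ y in T, unitsDensity y ∂dx := by
        rw [← mul_assoc, ← unitsDensity_mul, Units.mul_inv, unitsDensity_one, one_mul]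

/-- `|N(x)|⁻¹ dx` is finite on compact subsets of `Aˣ` (the density is continuous, hence bounded, on
the compact image in `A`). [folklore] -/
theorem isFiniteMeasureOnCompacts_unitsHaarOfAddHaar :
    IsFiniteMeasureOnCompacts (unitsHaarOfAddHaar dx) := by
  refine ⟨fun C hC => ?_⟩
  rw [unitsHaarOfAddHaar_apply dx hC.isClosed.measurableSet]
  have hC' : IsCompact (Units.val '' C) := hC.image Units.continuous_val
  -- the density is continuous on the set of units, hence bounded on `val '' C`
  have hcont : ContinuousOn (fun x : A => |(Algebra.norm ℝ x)⁻¹|) (Units.val '' C) := by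
    refine continuous_abs.comp_continuousOn (continuous_algebraNorm.continuousOn.inv₀ ?_)
    rintro _ ⟨u, -, rfl⟩
    exact algebraNorm_ne_zero_of_isUnit u.isUnit
  obtain ⟨M, hM⟩ := hC'.exists_bound_of_continuousOn hcont
  calc ∫⁻ x in Units.val '' C, unitsDensity x ∂dx
      ≤ ∫⁻ _ in Units.val '' C, ENNReal.ofReal M ∂dx := by
        refine setLIntegral_mono measurable_const fun x hx => ?_
        rw [unitsDensity_apply]
        exact ENNReal.ofReal_le_ofReal ((le_abs_self _).trans ((Real.norm_eq_abs _).symm.le.trans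
          (hM x hx)))
    _ = ENNReal.ofReal M * dx (Units.val '' C) := setLIntegral_const _ _
    _ < ⊤ := ENNReal.mul_lt_top ENNReal.ofReal_lt_top hC'.measure_lt_top

/-- `|N(x)|⁻¹ dx` charges every non-empty open subset of `Aˣ` (its image is a non-empty open subset
of `A`, of positive additive Haar measure, on which the density does not vanish). [folklore] -/
theorem isOpenPosMeasure_unitsHaarOfAddHaar : (unitsHaarOfAddHaar dx).IsOpenPosMeasure := by
  refine ⟨fun U hU hne => ?_⟩
  have hU' : IsOpen (Units.val '' U) := (Units.isOpenMap_val (R := A)) U hU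
  rw [unitsHaarOfAddHaar_apply dx hU.measurableSet, ← withDensity_apply _ hU'.measurableSet, Ne,
    withDensity_apply_eq_zero' measurable_unitsDensity.aemeasurable]
  have hsub : Units.val '' U ⊆ {x : A | unitsDensity x ≠ 0} ∩ Units.val '' U := by
    rintro _ ⟨u, hu, rfl⟩
    exact ⟨unitsDensity_ne_zero_of_isUnit u.isUnit, u, hu, rfl⟩
  exact fun h0 => (hU'.measure_pos dx (hne.image _)).ne' (measure_mono_null hsub h0)

/-- **`|N_{A/ℝ}(x)|⁻¹ dx` is a Haar measure on `Aˣ`** (classical; for `A = M_n(ℝ)`: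
`|det x|^{-n} dx` is the Haar measure of `GL_n(ℝ)`, the measure of the archimedean local zeta
integrals of Godement–Jacquet (1972), §8). [folklore] -/
theorem isHaarMeasure_unitsHaarOfAddHaar : (unitsHaarOfAddHaar dx).IsHaarMeasure :=
  have := isMulLeftInvariant_unitsHaarOfAddHaar dx
  have := isFiniteMeasureOnCompacts_unitsHaarOfAddHaar dx
  have := isOpenPosMeasure_unitsHaarOfAddHaar dx
  {}

end Density

/-! ### Every Haar measure on `Aˣ` is `c |N(x)|⁻¹ dx` -/

section Unique

variable {A : Type*} [NormedRing A] [NormedAlgebra ℝ A] [FiniteDimensional ℝ A]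

/-- A finite-dimensional real normed algebra has summable geometric series (it is complete).
[folklore] -/
theorem hasSummableGeomSeries_of_finiteDimensional : HasSummableGeomSeries A :=
  haveI : CompleteSpace A := FiniteDimensional.complete ℝ A
  inferInstance

attribute [local instance] hasSummableGeomSeries_of_finiteDimensional
  Units.borelSpace_of_isOpenEmbedding

variable [MeasurableSpace A] [BorelSpace A] (dx : Measure A) [dx.IsAddHaarMeasure]

/-- **Every Haar measure on `Aˣ` is a positive multiple of `|N(x)|⁻¹ dx`**: for a Haar measure `ρ` on
the unit group of a finite-dimensional real normed algebra there is `c ∈ (0, ∞)` with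
`∫_{Aˣ} g(u) dρ(u) = c ∫_{x unit} g(x) |N_{A/ℝ}(x)|⁻¹ dx` for every measurable `g ≥ 0` on `A`
(uniqueness of Haar measure on the second countable locally compact group `Aˣ`, Mathlib
`isMulLeftInvariant_eq_smul`, applied to `isHaarMeasure_unitsHaarOfAddHaar`). [folklore] -/
theorem exists_lintegral_units_eq_mul_lintegral (ρ : Measure Aˣ) [ρ.IsHaarMeasure] :
    ∃ c : ℝ≥0, 0 < c ∧ ∀ g : A → ℝ≥0∞, Measurable g →
      ∫⁻ u, g (u : A) ∂ρ = c * ∫⁻ x in {x : A | IsUnit x}, g x * unitsDensity x ∂dx := by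
  haveI : ProperSpace A := FiniteDimensional.proper ℝ A
  haveI : LocallyCompactSpace Aˣ := Units.locallyCompactSpace
  haveI : SecondCountableTopology Aˣ := Units.secondCountableTopology
  haveI := isHaarMeasure_unitsHaarOfAddHaar dx
  refine ⟨ρ.haarScalarFactor (unitsHaarOfAddHaar dx),
    haarScalarFactor_pos_of_isHaarMeasure ρ (unitsHaarOfAddHaar dx), fun g hg => ?_⟩
  conv_lhs => rw [isMulLeftInvariant_eq_smul ρ (unitsHaarOfAddHaar dx)]
  rw [lintegral_smul_measure, lintegral_unitsHaarOfAddHaar dx hg]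
  rfl

/-- **Integrability criterion.** For a Haar measure `ρ` on `Aˣ` and a Borel measurable
`g : A → ℝ`: if `x ↦ |N(x)|⁻¹ g(x)` is integrable on the set of units for `dx`, then `u ↦ g(u)` is
`ρ`-integrable (`∫ |g(u)| dρ = c ∫_{units} |N|⁻¹ |g| dx < ∞`). This is how the convergence of an
integral over `GL_n(ℝ)` against `d^×x` is read off from an integral over `M_n(ℝ)` against Lebesgue
measure. [folklore] -/
theorem integrable_comp_val_of_integrable (ρ : Measure Aˣ) [ρ.IsHaarMeasure] {g : A → ℝ}
    (hgm : Measurable g)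
    (hg : Integrable (fun x => |(Algebra.norm ℝ x)⁻¹| * g x) (dx.restrict {x : A | IsUnit x})) :
    Integrable (fun u : Aˣ => g (u : A)) ρ := by
  obtain ⟨c, -, hc⟩ := exists_lintegral_units_eq_mul_lintegral dx ρ
  refine ⟨(hgm.comp measurableEmbedding_unitsVal.measurable).aestronglyMeasurable, ?_⟩
  have hfin := hg.hasFiniteIntegral
  rw [hasFiniteIntegral_iff_enorm] at hfin ⊢
  have key := hc (fun x => ‖g x‖ₑ) hgm.enorm
  have heq : ∫⁻ x in {x : A | IsUnit x}, ‖g x‖ₑ * unitsDensity x ∂dx =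
      ∫⁻ x in {x : A | IsUnit x}, ‖|(Algebra.norm ℝ x)⁻¹| * g x‖ₑ ∂dx := by
    refine lintegral_congr fun x => ?_
    rw [enorm_mul, unitsDensity_apply, Real.enorm_eq_ofReal_abs, Real.enorm_eq_ofReal_abs, abs_abs,
      mul_comm]
  calc ∫⁻ u, ‖g (u : A)‖ₑ ∂ρ = c * ∫⁻ x in {x : A | IsUnit x}, ‖g x‖ₑ * unitsDensity x ∂dx := key
    _ < ⊤ := by
      rw [heq]
      exact ENNReal.mul_lt_top ENNReal.coe_lt_top hfin

end Unique

end Literature.MeasureTheory.Group
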